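import Literature.MathematicalPhysics.StatisticalMechanics.Knauf1998.Transport
import HarnessLib

/-!
# Knauf (1998), Sect. 6: "the graphs `G_d` are bipartite Ramanujan" — false at `d = 15`:
# `λ = (√10 + √5 + √2 − 1)/2 = 2.906…  ∈ (2√2, 3)` is an adjacency eigenvalue of `G₁₅`

Source: A. Knauf, *The number-theoretical spin chain and the Riemann zeroes*, Comm. Math. Phys. **196** (1998)
703–731, doi:10.1007/s002200050441 [Knauf1998], Sect. 6 (Definitions 12, 13 and the Conjecture stated after them);
restated in A. Knauf, *Number theory, dynamical systems and statistical mechanics*, Rev. Math. Phys. **11** (1999)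
1027–1060, §4.

What is proved (kernel-checked, standard axioms; no `native_decide`).
* `isAdjEigenvalue_G15 : IsAdjEigenvalue (G 15) lam` with `lam = (√10 + √5 + √2 − 1)/2`, and
  `lam_bounds : 2 * √2 < lam ∧ lam < 3` (numerically `λ = 2.90627…`, `2√2 = 2.82842…`);
* `G15_not_bipartiteRamanujan : ¬ IsBipartiteRamanujan (G 15) 3` and
  `allGdBipartiteRamanujan_false : ¬ AllGdBipartiteRamanujan` (the negation of the cited definition of module `Graph`;
  the source's "Conjecture" of Sect. 6, bundle name `knaufConjecture_false`); `exists_bad_eigenvalue` (quantitative form).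

The witness and how it is certified.  The 2001 H21 study found (by exact computation in the group algebra) that the
third largest adjacency eigenvalue of `G₁₅` is `μ_b(G₁₅) = (√10+√5+√2−1)/2 > 2√2`, carried by the 4-dimensional
representation `ρ ⊗ σ` of `SL(2,ℤ/15) = SL(2,𝔽₃) × SL(2,𝔽₅)`.  Here the eigenvalue is certified DIRECTLY by an exact
eigenvector, which needs no spectral theory: with `B` the `960 × 960` biadjacency matrix of `G₁₅` and
`x₁ = λ² = (9 + √5 + 4√2)/2`, the table `Compute.vTab` is a vector `v ∈ ℤ[√2,√5]^{V₋}` with `BᵀB v = x₁ v`; then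
`f₋ := 2λ·v`, `f₊ := 2·Bv` satisfy `A f = λ f` for the adjacency operator `A = [[0,B],[Bᵀ,0]]`.  The KERNEL checks
(`Kernel1..5`) the identity and the invariances for all 2880 group elements; `Transport` supplies the dictionary; this
module supplies `a+b√2+c√5+d√10 ↦ ℝ` as a ring map on the table entries (`evalK_kmul`), `2λ² = 9+4√2+√5`
(`two_lam_sq`), `A f = λ f` vertex by vertex (`sum_vP`, `sum_vM`), `f ≠ 0` (`f = 4λ` at the `M₋`-orbit of
`[[0,1],[14,1]]`), and `2√2 < λ < 3` from decimal bounds on `√2, √5, √10`.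

NOT claimed: that `λ` is the third largest eigenvalue in absolute value (true by the 2001 computation, not needed),
connectedness of `G₁₅`, anything about other moduli (2001: `G_d` Ramanujan for `3 ≤ d ≤ 14`; not for
`d = 15, 21, 29, 33, 37, 43, 47`), or any consequence for the spin chain.

Provenance: refutations bundle `papers/_cross/refutations` (H21 seat pub-refute-2, 2026-08-18), package module
`Refutations.Knauf1998 (§§ eigenvalue, theorems)`, moved into the tree under the Lean-in-tree rule (human 2026-08-18); the eigenvector
table was GENERATED by that bundle's `tools/knauf_g15_gen.py` (pure Python, exact arithmetic; `--check` re-derives the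
data file byte-for-byte) from the 2001 H21 study (archive `summits/rh/routes/knauf-spin-chain-ramanujan`).
-/

namespace Literature.MathematicalPhysics.StatisticalMechanics.Knauf1998

open Compute (T4 K4)

/-! ## The eigenvalue `λ` and the eigenvector -/

/-- `λ = (√10 + √5 + √2 − 1)/2 = 2.90627…`, the positive root of `λ² = x₁ = (9 + √5 + 4√2)/2`. [folklore] -/
noncomputable def lam : ℝ := (√10 + √5 + √2 - 1) / 2

/-- Auxiliary lemma: `: √2 * √2 = (2 : ℝ)`. [folklore] -/
private theorem sqrt_two_mul_sqrt_two : √2 * √2 = (2 : ℝ) := Real.mul_self_sqrt (by norm_num)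
/-- Auxiliary lemma: `: √5 * √5 = (5 : ℝ)`. [folklore] -/
private theorem sqrt_five_mul_sqrt_five : √5 * √5 = (5 : ℝ) := Real.mul_self_sqrt (by norm_num)
/-- Auxiliary lemma: `: √10 = √2 * √5`. [folklore] -/
private theorem sqrt_ten_eq : √10 = √2 * √5 := by
  rw [← Real.sqrt_mul (by norm_num : (0 : ℝ) ≤ 2)]; norm_num

/-- Auxiliary lemma: `: 2 * lam ^ 2 = 9 + 4 * √2 + √5`. [folklore] -/
theorem two_lam_sq : 2 * lam ^ 2 = 9 + 4 * √2 + √5 := by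
  rw [lam, sqrt_ten_eq]
  linear_combination ((√5 + 1) ^ 2 / 2) * sqrt_two_mul_sqrt_two + ((2 * √2 + 3) / 2) * sqrt_five_mul_sqrt_five

/-- Auxiliary lemma: `: 1.414 < √2 ∧ √2 < 1.4143`. [folklore] -/
private theorem sqrt_two_bounds : 1.414 < √2 ∧ √2 < 1.4143 :=
  ⟨(Real.lt_sqrt (by norm_num)).2 (by norm_num), (Real.sqrt_lt' (by norm_num)).2 (by norm_num)⟩
/-- Auxiliary lemma: `: 2.236 < √5 ∧ √5 < 2.2361`. [folklore] -/
private theorem sqrt_five_bounds : 2.236 < √5 ∧ √5 < 2.2361 :=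
  ⟨(Real.lt_sqrt (by norm_num)).2 (by norm_num), (Real.sqrt_lt' (by norm_num)).2 (by norm_num)⟩
/-- Auxiliary lemma: `: 3.1622 < √10 ∧ √10 < 3.1623`. [folklore] -/
private theorem sqrt_ten_bounds : 3.1622 < √10 ∧ √10 < 3.1623 :=
  ⟨(Real.lt_sqrt (by norm_num)).2 (by norm_num), (Real.sqrt_lt' (by norm_num)).2 (by norm_num)⟩

/-- `2√2 < λ < 3`: `λ` is a NON-trivial eigenvalue ABOVE the Ramanujan bound `2√(3−1)`. [folklore] -/
theorem lam_bounds : 2 * √2 < lam ∧ lam < 3 := by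
  obtain ⟨h₁, h₂⟩ := sqrt_two_bounds
  obtain ⟨h₃, h₄⟩ := sqrt_five_bounds
  obtain ⟨h₅, h₆⟩ := sqrt_ten_bounds
  rw [lam]
  constructor <;> linarith

/-- Auxiliary lemma: `: 0 < lam`. [folklore] -/
theorem lam_pos : 0 < lam := lt_trans (by positivity) lam_bounds.1

/-- `(a,b,c,d) ↦ a + b√2 + c√5 + d√10 ∈ ℝ`. [folklore] -/
noncomputable def evalK (x : K4) : ℝ := (x.1 : ℝ) + (x.2.1 : ℝ) * √2 + (x.2.2.1 : ℝ) * √5 + (x.2.2.2 : ℝ) * √10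

/-- Auxiliary lemma: `(x y : K4) : evalK (Compute.kadd x y) = evalK x + evalK y`. [folklore] -/
theorem evalK_kadd (x y : K4) : evalK (Compute.kadd x y) = evalK x + evalK y := by
  obtain ⟨a, b, c, e⟩ := x; obtain ⟨a', b', c', e'⟩ := y
  simp only [evalK, Compute.kadd]
  push_cast
  ring

/-- Auxiliary lemma: `(n : ℤ) (x : K4) : evalK (Compute.kscal n x) = n * evalK x`. [folklore] -/
theorem evalK_kscal (n : ℤ) (x : K4) : evalK (Compute.kscal n x) = n * evalK x := by
  obtain ⟨a, b, c, e⟩ := x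
  simp only [evalK, Compute.kscal]
  push_cast
  ring

/-- `evalK` is multiplicative: the kernel's `kmul` IS multiplication in `ℤ[√2,√5] ⊂ ℝ`. [folklore] -/
theorem evalK_kmul (x y : K4) : evalK (Compute.kmul x y) = evalK x * evalK y := by
  obtain ⟨a, b, c, e⟩ := x; obtain ⟨a', b', c', e'⟩ := y
  simp only [evalK, Compute.kmul]
  push_cast
  rw [sqrt_ten_eq]
  linear_combination (-((b : ℝ) * b' + b * e' * √5 + e * b' * √5 + e * e' * (√5 * √5))) * sqrt_two_mul_sqrt_two
    + (-((c : ℝ) * c' + c * e' * √2 + e * c' * √2 + 2 * (e * e'))) * sqrt_five_mul_sqrt_five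

/-- Auxiliary lemma: `: evalK Compute.twoX1 = 2 * lam ^ 2`. [folklore] -/
theorem evalK_twoX1 : evalK Compute.twoX1 = 2 * lam ^ 2 := by
  rw [two_lam_sq, evalK, Compute.twoX1]; push_cast; ring

/-- The eigenvector on `V₊`: `f₊ = 2·(Bv)`. [folklore] -/
noncomputable def fP (g : SL2 15) : ℝ := 2 * evalK (Compute.sP (nt g))

/-- The eigenvector on `V₋`: `f₋ = 2λ·v`. [folklore] -/
noncomputable def fM (g : SL2 15) : ℝ := 2 * lam * evalK (Compute.v (nt g))

/-- Auxiliary lemma: `(g h : SL2 15) (r : RelP g h) : fP g = fP h`. [folklore] -/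
theorem fP_congr (g h : SL2 15) (r : RelP g h) : fP g = fP h := by
  rcases r with rfl | rfl | rfl
  · rfl
  · rw [fP, fP, sP_mulP]
  · rw [fP, fP, sP_mulP, sP_mulP]

/-- Auxiliary lemma: `(g h : SL2 15) (r : RelM g h) : fM g = fM h`. [folklore] -/
theorem fM_congr (g h : SL2 15) (r : RelM g h) : fM g = fM h := by
  rcases r with rfl | rfl | rfl
  · rfl
  · rw [fM, fM, v_mulM]
  · rw [fM, fM, v_mulM, v_mulM]

/-- The eigenvector `f = (f₊, f₋)` on `V = V₊ ⊔ V₋`. [folklore] -/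
noncomputable def f : V 15 → ℝ :=
  Sum.elim (Quotient.lift (s := setoidP 15) fP fP_congr) (Quotient.lift (s := setoidM 15) fM fM_congr)

/-- Auxiliary lemma: `(g : SL2 15) : f (vP g) = fP g`. [folklore] -/
@[simp] theorem f_vP (g : SL2 15) : f (vP g) = fP g := rfl

/-- Auxiliary lemma: `(g : SL2 15) : f (vM g) = fM g`. [folklore] -/
@[simp] theorem f_vM (g : SL2 15) : f (vM g) = fM g := rfl

/-- Auxiliary lemma: `(g : SL2 15) : fP g = 2 * (evalK (Compute.v (nt g)) + evalK (Compute.v (nt (mulP g))) + evalK (Compute.v (nt (mulP (mulP g)))))`. [folklore] -/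
theorem fP_eq (g : SL2 15) : fP g = 2 * (evalK (Compute.v (nt g)) + evalK (Compute.v (nt (mulP g))) +
    evalK (Compute.v (nt (mulP (mulP g))))) := by
  simp only [fP, Compute.sP, evalK_kadd, nt_mulP]; ring

/-- `(A f)(v₊) = λ f(v₊)` at every vertex of `V₊`. [folklore] -/
theorem sum_vP (g : SL2 15) {_hF : Fintype ((G 15).neighborSet (vP g))} :
    ∑ u ∈ (G 15).neighborFinset (vP g), f u = lam * f (vP g) := by
  rw [neighborFinset_vP, Finset.sum_insert (by simp [vM_ne₁ g, vM_ne₂ g]), Finset.sum_pair (vM_ne₃ g),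
    f_vP, f_vM, f_vM, f_vM, fM, fM, fM, fP_eq]
  ring

/-- `(A f)(v₋) = λ f(v₋)` at every vertex of `V₋` — this is where the kernel's `BᵀB`-identity and `2λ² = 9+4√2+√5`
enter. [folklore] -/
theorem sum_vM (g : SL2 15) {_hF : Fintype ((G 15).neighborSet (vM g))} :
    ∑ u ∈ (G 15).neighborFinset (vM g), f u = lam * f (vM g) := by
  rw [neighborFinset_vM, Finset.sum_insert (by simp [vP_ne₁ g, vP_ne₂ g]), Finset.sum_pair (vP_ne₃ g),
    f_vM, f_vP, f_vP, f_vP, fP, fP, fP, fM]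
  have h := congrArg evalK (eigen_eq g)
  rw [evalK_kmul, evalK_kscal, evalK_kadd, evalK_kadd, evalK_twoX1] at h
  push_cast at h
  linear_combination (-1 : ℝ) * h

/-- The edge `[[0,1],[14,1]]`, at whose `M₋`-orbit `v = 2`. [folklore] -/
def g₀ : SL2 15 := ⟨(0, 1, 14, 1), by decide⟩

/-- Auxiliary lemma: `: f (vM g₀) = 4 * lam`. [folklore] -/
theorem f_vM_g₀ : f (vM g₀) = 4 * lam := by
  have h : Compute.v (nt g₀) = (2, 0, 0, 0) := by decide +kernel
  rw [f_vM, fM, h, evalK]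
  push_cast
  ring

/-- Auxiliary lemma: `: f ≠ 0`. [folklore] -/
theorem f_ne_zero : f ≠ 0 := fun h => by
  have := congrFun h (vM g₀)
  rw [f_vM_g₀, Pi.zero_apply] at this
  linarith [lam_pos]

/-! ## The theorems -/

/-- **`λ = (√10+√5+√2−1)/2` is an adjacency eigenvalue of `G₁₅`**, with the explicit eigenvector `f`. [folklore] -/
theorem isAdjEigenvalue_G15 : IsAdjEigenvalue (G 15) lam := by
  refine ⟨f, f_ne_zero, ?_⟩
  funext x
  rw [SimpleGraph.adjMatrix_mulVec_apply, Pi.smul_apply, smul_eq_mul]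
  rcases x with x | x
  · obtain ⟨g, hg⟩ := vP_surjective_left x
    rw [← hg]
    exact sum_vP g
  · obtain ⟨g, hg⟩ := vM_surjective_right x
    rw [← hg]
    exact sum_vM g

/-- **`G₁₅` is not bipartite Ramanujan**: `λ` is an eigenvalue with `2√2 < |λ| < 3`. [folklore] -/
theorem G15_not_bipartiteRamanujan : ¬ IsBipartiteRamanujan (G 15) 3 := by
  intro h
  have hb := lam_bounds
  have habs : |lam| = lam := abs_of_pos lam_pos
  have h2 : (2 : ℝ) * √(((3 : ℕ) : ℝ) - 1) = 2 * √2 := by norm_num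
  rcases h lam isAdjEigenvalue_G15 with h₁ | h₁
  · rw [habs] at h₁
    have h₃ : lam = 3 := by exact_mod_cast h₁
    linarith
  · rw [habs, h2] at h₁
    linarith

/-- **The printed claim of Knauf (1998), Sect. 6 — "the graphs `G_d` are bipartite Ramanujan" for all `d ≥ 3`
(`AllGdBipartiteRamanujan`, module `Graph`) — is FALSE**: it fails at `d = 15` (`G15_not_bipartiteRamanujan`). [folklore] -/
theorem allGdBipartiteRamanujan_false : ¬ AllGdBipartiteRamanujan := fun h =>
  G15_not_bipartiteRamanujan (h 15 (by norm_num))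

/-- The witness in quantitative form. [folklore] -/
theorem exists_bad_eigenvalue :
    ∃ μ : ℝ, IsAdjEigenvalue (G 15) μ ∧ 2 * √2 < |μ| ∧ |μ| < 3 :=
  ⟨lam, isAdjEigenvalue_G15, by rw [abs_of_pos lam_pos]; exact lam_bounds.1,
    by rw [abs_of_pos lam_pos]; exact lam_bounds.2⟩

end Literature.MathematicalPhysics.StatisticalMechanics.Knauf1998
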